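import Literature.AnabelianGeometry.SemiGraphs.ChartFibreFunctor
import Literature.AnabelianGeometry.Anabelioids.FiniteEtaleFiberFunctor
import HarnessLib

/-!
# [SemiAnbd] §3 Prop. 3.6 (iii): the chart basepoint of `B(𝒢)` is a fibre functor, and
# `π₁^temp(𝒢)` acts continuously on it (towards `π̂₁(B(𝒢)) = π₁^temp(𝒢)^∧`)

Mochizuki, *Semi-graphs of anabelioids*, Publ. RIMS **42** (2006), Prop. 3.6 (iii) p. 38: "The full
embedding `B(G) ↪ B^temp(G)` induces an injection `π₁^temp(G) ↪ π̂₁(G)` of topological groups" (whence,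
the finite objects of `B^temp(G)` being the finite étale coverings, "`π̂₁(G)` is the profinite completion
of `π₁^temp(G)`") [cite: MochizukiSemiAnbd2006, Prop 3.6(iii) p.38].  Sequel to `ChartFibreFunctor.lean`
(abc-iut L3 bridge B7c-Π / B7b part 1):

* `finite_chartFibre` — along a verticial homomorphism the chart fibres `|c(X)|` are finite
  (`≅ |X_v|`), so the chart fibre functor lifts to `chartFibreFin : B(𝒢.toAnab) ⥤ FintypeCat` with
  `chartFibreFin ⋙ incl = chartFibre`;
* `chartFibreFinIsoρ` — `chartFibreFin ≅ ρ_v ⋙ forget`, t1's basepoint of `B(𝒢.toAnab)` THROUGH THE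
  VERTEX `v` at the forgetful basepoint of `B(Π_v)`; hence (`nonempty_fiberFunctor_chartFibreFin`) the
  chart basepoint IS a fibre functor of the Galois category `B(𝒢.toAnab)` (connected `𝒢`), and
  `π̂₁(B(𝒢))` may be taken to be `Aut (chartFibreFin)`;
* `chartActionFin : π₁^temp(𝒢) →* Aut (chartFibreFin)` — the homomorphism of Prop. 3.6 (iii), with
  `chartActionFin_hom_app_apply` (acts by `ρ`) and `continuous_chartActionFin` (open point stabilisers).

Density of the image and the identification of the kernel with the residually-finite kernel (so that
`Aut (chartFibreFin)` is the profinite completion; injectivity = `TemperedPiResiduallyFinite`) are the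
sequel.  Nothing here takes a side on [IUTchIII] Cor. 3.12.
-/

noncomputable section

namespace Literature.AnabelianGeometry.SemiGraphs

open CategoryTheory CategoryTheory.Limits CategoryTheory.PreGaloisCategory
open Literature.AnabelianGeometry.Anabelioids
open Literature.AlgebraicGeometry.Frobenioids (BCat)
open scoped FintypeCatDiscrete Pointwise

universe u

namespace ProfiniteSemiGraph

variable {𝒢 : ProfiniteSemiGraph.{u}}
variable (c : TemperedPiChart 𝒢) (h𝒢 : ∀ S : CovObj 𝒢, S.IsFinite → S.IsTempered)

/-! ### Finiteness of the chart fibres -/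

/-- **The chart fibres of finite étale coverings are finite**: `|c(X)| ≅ |X_v|` along a verticial
homomorphism at any vertex `v` ([SemiAnbd] Thm. 3.7 (i) / Prop. 3.6 (iii): finite étale coverings stay
finite in `B^temp(π₁^temp(G))`). [cite: MochizukiSemiAnbd2006, Prop 3.6(iii) p.38] -/
theorem finite_chartFibre (v : 𝒢.graph.Vertex) (ψ : 𝒢.Gv v →ₜ* c.G)
    (e : c.equiv.inverse ⋙ ObjectProperty.ι _ ⋙ restrictV 𝒢 v ≅ BTemp.res ψ) (X : 𝒢.toAnab.BObj) :
    Finite ((chartFibre c h𝒢).obj X) :=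
  Finite.of_equiv ((X.S v).obj.V) ((chartFibreIsoρ c h𝒢 v ψ e).app X).toEquiv.symm

/-- **The chart basepoint with finite values**: `chartFibre` lifted to `FintypeCat` over a finiteness
witness (e.g. `finite_chartFibre`). [cite: MochizukiSemiAnbd2006, Prop 3.6(iii) p.38] -/
def chartFibreFin (hfin : ∀ X : 𝒢.toAnab.BObj, Finite ((chartFibre c h𝒢).obj X)) :
    𝒢.toAnab.BObj ⥤ FintypeCat.{u} where
  obj X := ⟨(chartFibre c h𝒢).obj X, hfin X⟩
  map f := FintypeCat.homMk ((chartFibre c h𝒢).map f)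
  map_id X := by
    apply ConcreteCategory.hom_ext
    intro x
    change ((chartFibre c h𝒢).map (𝟙 X)) x = x
    rw [(chartFibre c h𝒢).map_id]
    rfl
  map_comp f g := by
    apply ConcreteCategory.hom_ext
    intro x
    change ((chartFibre c h𝒢).map (f ≫ g)) x =
      ((chartFibre c h𝒢).map g) (((chartFibre c h𝒢).map f) x)
    rw [(chartFibre c h𝒢).map_comp]
    rfl

variable (hfin : ∀ X : 𝒢.toAnab.BObj, Finite ((chartFibre c h𝒢).obj X))

/-- `chartFibreFin` lies over `chartFibre` (definitional). [cite: MochizukiSemiAnbd2006, Prop 3.6(iii) p.38] -/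
theorem chartFibreFin_comp_incl : chartFibreFin c h𝒢 hfin ⋙ FintypeCat.incl = chartFibre c h𝒢 := rfl

/-- The underlying set of `chartFibreFin X` is the chart fibre (definitional).
[cite: MochizukiSemiAnbd2006, Prop 3.6(iii) p.38] -/
theorem chartFibreFin_obj (X : 𝒢.toAnab.BObj) :
    ((chartFibreFin c h𝒢 hfin).obj X : Type u) = (chartFibre c h𝒢).obj X := rfl

/-- **`chartFibreFin ≅ ρ_v ⋙ forget`** — the chart basepoint is t1's basepoint of `B(𝒢.toAnab)` through
the vertex `v` (at the forgetful basepoint of `B(Π_v)`), along a verticial homomorphism.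
[cite: MochizukiSemiAnbd2006, Thm 3.7(i) p.40] -/
def chartFibreFinIsoρ (v : 𝒢.graph.Vertex) (ψ : 𝒢.Gv v →ₜ* c.G)
    (e : c.equiv.inverse ⋙ ObjectProperty.ι _ ⋙ restrictV 𝒢 v ≅ BTemp.res ψ) :
    chartFibreFin c h𝒢 hfin ≅
      𝒢.toAnab.ρ v ⋙ ObjectProperty.ι (Action.IsContinuous (V := FintypeCat.{u}) (G := 𝒢.Gv v)) ⋙
        Action.forget FintypeCat.{u} (𝒢.Gv v) :=
  NatIso.ofComponents
    (fun X => FintypeCat.equivEquivIso ((chartFibreIsoρ c h𝒢 v ψ e).app X).toEquiv)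
    (fun {X Y} f => by
      apply ConcreteCategory.hom_ext
      intro x
      exact ConcreteCategory.congr_hom ((chartFibreIsoρ c h𝒢 v ψ e).hom.naturality f) x)

/-- On elements `chartFibreFinIsoρ` is `chartFibreIsoρ`. [cite: MochizukiSemiAnbd2006, Thm 3.7(i) p.40] -/
theorem chartFibreFinIsoρ_hom_app_apply (v : 𝒢.graph.Vertex) (ψ : 𝒢.Gv v →ₜ* c.G)
    (e : c.equiv.inverse ⋙ ObjectProperty.ι _ ⋙ restrictV 𝒢 v ≅ BTemp.res ψ) (X : 𝒢.toAnab.BObj)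
    (y : (chartFibreFin c h𝒢 hfin).obj X) :
    ((chartFibreFinIsoρ c h𝒢 hfin v ψ e).hom.app X) y = (chartFibreIsoρ c h𝒢 v ψ e).hom.app X y := rfl

/-- **The chart basepoint is a fibre functor of `B(𝒢.toAnab)`** (for connected `𝒢`): transported from
t1's basepoint `ρ_v ⋙ forget` (`fiberFunctor_ρ`, `fiberFunctor_forget_bCat`) along `chartFibreFinIsoρ`
— so `Aut (chartFibreFin)` is a model of `π̂₁(B(𝒢))`. [cite: MochizukiSemiAnbd2006, Prop 3.6(iii) p.38] -/
theorem nonempty_fiberFunctor_chartFibreFin (hc : 𝒢.toAnab.IsConnected) (v : 𝒢.graph.Vertex)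
    (ψ : 𝒢.Gv v →ₜ* c.G) (e : c.equiv.inverse ⋙ ObjectProperty.ι _ ⋙ restrictV 𝒢 v ≅ BTemp.res ψ) :
    letI := 𝒢.toAnab.preGaloisCategory_bObj
    Nonempty (FiberFunctor (chartFibreFin c h𝒢 hfin)) := by
  letI := 𝒢.toAnab.preGaloisCategory_bObj
  haveI := @SemiGraphOfAnabelioids.fiberFunctor_ρ 𝒢.toAnab hc v
    (ObjectProperty.ι (Action.IsContinuous (V := FintypeCat.{u}) (G := 𝒢.Gv v)) ⋙
      Action.forget FintypeCat.{u} (𝒢.Gv v)) (fiberFunctor_forget_bCat (𝒢.Gv v))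
  exact nonempty_fiberFunctor_of_iso (chartFibreFinIsoρ c h𝒢 hfin v ψ e)

/-! ### The continuous action of `π₁^temp(𝒢)` on the chart basepoint -/

/-- **Prop. 3.6 (iii), the homomorphism `π₁^temp(𝒢) → Aut(chart basepoint)`** with finite values:
`g` acts on `c(X)` by `ρ(g)`. [cite: MochizukiSemiAnbd2006, Prop 3.6(iii) p.38] -/
def chartActionFin : c.G →* Aut (chartFibreFin c h𝒢 hfin) where
  toFun g :=
    NatIso.ofComponents
      (fun X => FintypeCat.equivEquivIso (((chartAction c h𝒢 g).app X).toEquiv))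
      (fun {X Y} f => by
        apply ConcreteCategory.hom_ext
        intro x
        exact ConcreteCategory.congr_hom ((chartAction c h𝒢 g).hom.naturality f) x)
  map_one' := by
    refine Iso.ext (NatTrans.ext (funext fun X => ?_))
    apply ConcreteCategory.hom_ext
    intro x
    change (chartAction c h𝒢 1).hom.app X x = x
    rw [map_one]
    rfl
  map_mul' g g' := by
    refine Iso.ext (NatTrans.ext (funext fun X => ?_))
    apply ConcreteCategory.hom_ext
    intro x
    change (chartAction c h𝒢 (g * g')).hom.app X x =
      (chartAction c h𝒢 g).hom.app X ((chartAction c h𝒢 g').hom.app X x)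
    rw [map_mul]
    rfl

/-- The finite-valued chart action on elements: `ρ(g)`. [cite: MochizukiSemiAnbd2006, Prop 3.6(iii) p.38] -/
@[simp] theorem chartActionFin_hom_app_apply (g : c.G) (X : 𝒢.toAnab.BObj)
    (y : (chartFibreFin c h𝒢 hfin).obj X) :
    (chartActionFin c h𝒢 hfin g).hom.app X y =
      (c.equiv.functor.obj ((𝒢.ofBObjTemp h𝒢).obj X)).obj.ρ g y := rfl

/-- **Continuity of `π₁^temp(𝒢) → Aut(chart basepoint)`** for the topology of automorphism groups of
fibre functors (generated by the point stabilisers), because the point stabilisers in `π₁^temp(𝒢)` are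
open ([SemiAnbd] §3 p. 33: continuous actions). [cite: MochizukiSemiAnbd2006, Prop 3.6(iii) p.38] -/
theorem continuous_chartActionFin : Continuous (chartActionFin c h𝒢 hfin) := by
  refine continuous_induced_rng.2 (continuous_pi fun X => ?_)
  refine continuous_discrete_rng.2 fun b => ?_
  rw [isOpen_iff_forall_mem_open]
  intro g₀ hg₀
  haveI : Finite ((chartFibre c h𝒢).obj X) := hfin X
  -- the kernel of the action on `X` is open
  let K : Set c.G := ⋂ x : (chartFibre c h𝒢).obj X, {g : c.G | (chartAction c h𝒢 g).hom.app X x = x}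
  have hK : IsOpen K := isOpen_iInter_of_finite fun x => isOpen_stabilizer_chartAction c h𝒢 X x
  refine ⟨(fun k => g₀ * k) '' K, ?_, isOpenMap_mul_left g₀ _ hK, ⟨1, ?_, mul_one g₀⟩⟩
  · rintro _ ⟨k, hk, rfl⟩
    have hk' : ∀ x : (chartFibre c h𝒢).obj X, (chartAction c h𝒢 k).hom.app X x = x :=
      fun x => Set.mem_iInter.mp hk x
    have key : autEmbedding (chartFibreFin c h𝒢 hfin) (chartActionFin c h𝒢 hfin (g₀ * k)) X =
        autEmbedding (chartFibreFin c h𝒢 hfin) (chartActionFin c h𝒢 hfin g₀) X := by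
      apply Iso.ext
      apply ConcreteCategory.hom_ext
      intro x
      change (chartAction c h𝒢 (g₀ * k)).hom.app X x = (chartAction c h𝒢 g₀).hom.app X x
      rw [map_mul]
      exact congrArg (fun y => (chartAction c h𝒢 g₀).hom.app X y) (hk' x)
    have hb : autEmbedding (chartFibreFin c h𝒢 hfin) (chartActionFin c h𝒢 hfin g₀) X = b := hg₀
    change autEmbedding (chartFibreFin c h𝒢 hfin) (chartActionFin c h𝒢 hfin (g₀ * k)) X ∈
      ({b} : Set _)
    rw [key, hb]
    exact Set.mem_singleton b
  · exact Set.mem_iInter.mpr fun x => by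
      change (chartAction c h𝒢 1).hom.app X x = x
      rw [map_one]
      rfl

end ProfiniteSemiGraph

end Literature.AnabelianGeometry.SemiGraphs

end
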